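import Literature.Computability.Cryptography.ChenQuantumLWESteps
import Literature.Computability.Cryptography.ChenQuantumLWEGeneralMeasurement
import HarnessLib

/-!
# Runbook sanity lemmas — `Chen2024.Shape` is inhabited and `Shape.Admissible` is satisfiable (REVIEW-RUNBOOK cards of `pub-lwe`)

Mechanical companion of the definition cards D1 `Shape` / D2 `Admissible` and of the hypothesis cards C1/C2
(`h : S.Admissible`) of `REVIEW-RUNBOOK.md` for the headline theorems `Shape.step9Needs_readout_le` and
`Shape.step9Needs_not_almostCertain_third` (cell `pub-lwe`, bundle `papers/QuantumAdvantage/lwe-quantum-autopsy`):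
(b) NON-VACUITY — the class the theorems quantify over (admissible shapes, Chen 2024 Cond. C.3 / eq. (12) / eq. (35) /
eq. (39)–(40)) is not empty.  The witness is the cell's own (`b2b-lwe-1/Gen25AdmissibleWitness.lean`, Part 1 gen 25,
2026-08-19T22:4xZ, farm rc 0 there): `n = 1, D = 1, p₁ = 3, Q = 5, b = (−1, 6), v′ = 0, b* = (5, 3), v* = 0`; this file only
gives it a tree home (generated/curated by `harness/kit/review_runbook.py`, ops-runbook seat).  Nothing here is used by the
theorems under review; these are reader-facing checks.
-/

namespace Summit.QuantumAdvantage.LweAutopsy.Runbook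

open Literature.Computability.Cryptography.Chen2024

/-- The concrete shape `S0`: one unknown-carrying coordinate (`n = 1`), scaling factor `D = 1`, planted primes
`p₁ = 3`, `Q = 5`, short vector `b = (−1, 6)`, `v′ = (0, 0)`, Step-9 data `b* = (5, 3)`, `v* = (0, 0)`. -/
def S0 : Shape :=
  { n := 1, D := 1, p₁ := 3, Q := 5, b := ![-1, 6], v' := ![0, 0], bstar := ![5, 3], vstar := ![0, 0] }

/-- (b) `S0` satisfies all fifteen fields of `Shape.Admissible` (Chen 2024 Cond. C.3 p. 18, eq. (12) p. 17, eq. (35) p. 31,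
eq. (39)–(40) p. 36): the hypothesis `h : S.Admissible` of the headline theorems is satisfiable, so they are not vacuous. -/
theorem S0_admissible : S0.Admissible where
  odd_D := by decide
  odd_p₁ := by decide
  odd_Q := by decide
  cop_Dp := by decide
  cop_DQ := by decide
  cop_pQ := by decide
  three_le_p₁ := by decide
  three_le_Q := by decide
  Q_mod := by decide
  b_head := by simp [S0]
  b_tail := by
    intro i hi
    fin_cases i
    · exact absurd rfl hi
    · show (2 * (3 : ℤ)) ∣ 6
      decide
  v'_in_DZ := by
    intro i
    fin_cases i <;> simp [S0]
  bstar_head := by simp [S0]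
  bstar_tail := by
    intro i hi
    fin_cases i
    · exact absurd rfl hi
    · show ((3 : ℕ) : ℤ) ∣ 3
      decide
  vstar_head := by simp [S0]

/-- (b) The record type `Shape` quantified over by the headline theorems is inhabited. -/
instance instNonemptyShape : Nonempty Shape := ⟨S0⟩

/-- (b) … and the SUBTYPE of admissible shapes is inhabited (the class Chen's algorithm must serve is non-empty). -/
theorem exists_admissible : ∃ S : Shape, S.Admissible := ⟨S0, S0_admissible⟩

/-- (b) `S0` has `0 < n` (`n = 1`), the side condition `hn : 0 < S.n` of `step9Needs_not_almostCertain_third`; so that corollary's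
hypotheses are jointly satisfiable too. -/
theorem S0_n_pos : 0 < S0.n := Nat.one_pos

open scoped ComplexOrder in
/-- (b) The textbook "constant measurement": the general measurement putting all weight on one outcome `k₀` — effects
`E_{k₀} = 1`, `E_k = 0` otherwise (Nielsen–Chuang §2.2.6: any family of positive operators summing to `1` is a POVM).  It is a
`POVM X κ` on every register type `X` and every finite outcome type `κ ∋ k₀`, so the measurement binder
`E : POVM (Fin (S.n+1) → ZMod S.M) (ZMod S.N)` of the headline theorems (card D `POVM`) is never vacuous. -/
def POVM.const (X κ : Type*) [Fintype X] [DecidableEq X] [Fintype κ] [DecidableEq κ] (k₀ : κ) : POVM X κ where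
  effect k := if k = k₀ then 1 else 0
  posSemidef k := by
    by_cases h : k = k₀
    · simp only [h, if_true]
      exact Matrix.PosSemidef.one
    · simp only [h, if_false]
      exact Matrix.PosSemidef.zero
  sum_eq_one := by
    simp [Finset.sum_ite_eq']

/-- (b) Hence the measurement type is inhabited as soon as the outcome type is (outcomes of the lwe theorems are residues
`ZMod S.N`, `N ≥ 1`, so `0` is an outcome). -/
instance instNonemptyPOVM (X κ : Type*) [Fintype X] [DecidableEq X] [Fintype κ] [Nonempty κ] : Nonempty (POVM X κ) := by
  classical
  exact ⟨POVM.const X κ (Classical.arbitrary κ)⟩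

/-- (b) In particular for the witness shape `S0`: a general measurement of its Step-8 register with outcomes in `ZMod S0.N`
exists, so ALL object binders of `step9Needs_readout_le` / `step9Needs_not_almostCertain_third` are jointly inhabited
(`S0`, `S0_admissible`, this measurement, any `U`, `ε = 1/3`). -/
example : Nonempty (POVM (Fin (S0.n + 1) → ZMod S0.M) (ZMod S0.N)) := inferInstance

end Summit.QuantumAdvantage.LweAutopsy.Runbook
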